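import Mathlib.Algebra.Polynomial.Splits
import Mathlib.FieldTheory.IsAlgClosed.Basic
import Mathlib.Analysis.Normed.Field.Basic
import HarnessLib

/-!
# [GenEll] Thm 2.1 for `ℙ¹` (route piece W7-β): a rational map keeps points far from its
# `{0,1,∞}`-fibre inside an annulus `{ρ' ≤ |w| ≤ 1/ρ', |w − 1| ≥ ρ'}`

Support lemma for the cell's number-field-only proof architecture of `GenEllTwo`
(stmt-ABC-19679; S. Mochizuki, *Arithmetic elliptic curves in general position*, Math. J. Okayama
Univ. **52** (2010), Thm. 2.1, proof pp. 12–14 [cite: MochizukiGenEll2010, Thm 2.1 p.11]; package map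
`GENELLTWO-P1ROUTE.md` of seat abc-iut-S6, §3 (a) and work package W7 "properness"): for the Belyi
factor `β = p/q : ℙ¹ → ℙ¹` of the noncritical Belyi map `φ = β ∘ t`, with `B ⊇ β⁻¹{0,1,∞} ∩ 𝔸¹` and
`β(∞) ∉ {0, 1, ∞}` (`deg p = deg q = deg (p − q)`), every point `z` that is `ρ`-far from `B` has
`β(z)` in the annulus `ρ' ≤ |β z| ≤ 1/ρ'`, `|β z − 1| ≥ ρ'`, for a `ρ' > 0` depending only on
`(p, q, ρ)`. The statement and proof are uniform over ANY normed field in which `p`, `q`, `p − q`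
split (so they serve both the archimedean place, `K = ℂ`, and the `2`-adic one,
`K = PadicAlgCl 2`, of the route): no compactness is used, only the root factorisations
`f = lc(f) · ∏ (X − a)` and the triangle inequality — `‖z − a‖ ≤ ‖z‖ + M` and
`‖z − a‖ ≥ max(ρ, ‖z‖ − M)` for roots `‖a‖ ≤ M` — which give two-sided bounds
`(γ U)^n ≤ ‖f(z)‖/‖lc f‖ ≤ U^n` with `U = ‖z‖ + M + 1`, `γ = min(ρ/(3M+3), 1/3)`.

Main results (no definitions; proof-only): `norm_eval_eq_prod_roots` (for split `f`, `‖f(z)‖ = ‖lc f‖ · ∏_{roots} ‖z − a‖`),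
`norm_eval_le_of_roots_le` / `le_norm_eval_of_far` (the two-sided bounds),
`exists_annulus_of_far_roots` (the annulus statement over the roots of `p`, `q`, `p − q`),
`exists_annulus_of_far` (the same with one finite set `B` containing all three root sets) and
`exists_annulus_of_far_of_isAlgClosed` (splitting automatic over an algebraically closed field).
Classical and undisputed; nothing here bears on [IUTchIII] Cor. 3.12.
-/

namespace Literature.NumberTheory.DiophantineGeometry.GenEll

open Polynomial

section Multiset

variable {α : Type*}

/-- A product of reals each at least `ρ ≥ 0` is at least `ρ ^ card`. [folklore] -/
private theorem pow_card_le_prod_map_of_le (s : Multiset α) (g : α → ℝ) {ρ : ℝ} (hρ : 0 ≤ ρ)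
    (h : ∀ a ∈ s, ρ ≤ g a) : ρ ^ Multiset.card s ≤ (s.map g).prod := by
  induction s using Multiset.induction_on with
  | empty => simp
  | cons a s ih =>
    rw [Multiset.card_cons, Multiset.map_cons, Multiset.prod_cons, pow_succ']
    have ha : ρ ≤ g a := h a (Multiset.mem_cons_self a s)
    have hs : ρ ^ Multiset.card s ≤ (s.map g).prod :=
      ih fun b hb => h b (Multiset.mem_cons_of_mem hb)
    exact mul_le_mul ha hs (pow_nonneg hρ _) (hρ.trans ha)

/-- A product of nonnegative reals each at most `T` is at most `T ^ card`. [folklore] -/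
private theorem prod_map_le_pow_card_of_le (s : Multiset α) (g : α → ℝ) {T : ℝ} (hg : ∀ a ∈ s, 0 ≤ g a)
    (h : ∀ a ∈ s, g a ≤ T) : (s.map g).prod ≤ T ^ Multiset.card s := by
  induction s using Multiset.induction_on with
  | empty => simp
  | cons a s ih =>
    rw [Multiset.card_cons, Multiset.map_cons, Multiset.prod_cons, pow_succ']
    have ha : g a ≤ T := h a (Multiset.mem_cons_self a s)
    have ha0 : 0 ≤ g a := hg a (Multiset.mem_cons_self a s)
    have hs : (s.map g).prod ≤ T ^ Multiset.card s :=
      ih (fun b hb => hg b (Multiset.mem_cons_of_mem hb)) fun b hb => h b (Multiset.mem_cons_of_mem hb)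
    have hs0 : 0 ≤ (s.map g).prod :=
      Multiset.prod_nonneg fun x hx => by
        obtain ⟨b, hb, rfl⟩ := Multiset.mem_map.mp hx
        exact hg b (Multiset.mem_cons_of_mem hb)
    exact mul_le_mul ha hs hs0 (ha0.trans ha)

end Multiset

section NormedField

variable {K : Type*} [NormedField K]

/-! ### Products over the roots -/

/-- `‖(∏_{a ∈ s} (X − a))(z)‖ = ∏_{a ∈ s} ‖z − a‖`. [folklore] -/
private theorem norm_eval_multiset_prod_X_sub_C (s : Multiset K) (z : K) :
    ‖((s.map fun a => X - C a).prod).eval z‖ = (s.map fun a => ‖z - a‖).prod := by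
  induction s using Multiset.induction_on with
  | empty => simp
  | cons a s ih =>
    simp only [Multiset.map_cons, Multiset.prod_cons, eval_mul, eval_sub, eval_X, eval_C,
      norm_mul, ih]

/-- For a split polynomial `f = lc(f) · ∏_{roots} (X − a)`: `‖f(z)‖ = ‖lc f‖ · ∏_{roots} ‖z − a‖`.
[folklore] -/
private theorem norm_eval_eq_prod_roots {f : K[X]} (hf : f.Splits) (z : K) :
    ‖f.eval z‖ = ‖f.leadingCoeff‖ * (f.roots.map fun a => ‖z - a‖).prod := by
  conv_lhs => rw [hf.eq_prod_roots]
  rw [eval_mul, eval_C, norm_mul, norm_eval_multiset_prod_X_sub_C]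

/-! ### Two-sided bounds for `‖f(z)‖` when the roots lie in the disc `‖a‖ ≤ M` -/

/-- KEY INEQUALITY with the separation constant `γ := min(ρ/(3M+3), 1/3)`: if `‖a‖ ≤ M` and
`ρ ≤ ‖z − a‖` then `γ · (‖z‖ + M + 1) ≤ ‖z − a‖` (case `‖z‖ ≤ 2M + 2`: the left side is `≤ ρ`;
case `‖z‖ > 2M + 2`: the left side is `≤ (‖z‖ + M + 1)/3 ≤ ‖z‖ − M ≤ ‖z − a‖`). [folklore] -/
private theorem sepConst_mul_le_norm_sub {M ρ : ℝ} (hM : 0 ≤ M) {z a : K} (ha : ‖a‖ ≤ M)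
    (hfar : ρ ≤ ‖z - a‖) : min (ρ / (3 * M + 3)) (1 / 3) * (‖z‖ + M + 1) ≤ ‖z - a‖ := by
  set γ : ℝ := min (ρ / (3 * M + 3)) (1 / 3) with hγ
  have hγ3 : γ ≤ 1 / 3 := min_le_right _ _
  have h3 : 0 < 3 * M + 3 := by linarith
  have hγρ : γ * (3 * M + 3) ≤ ρ :=
    calc γ * (3 * M + 3) ≤ ρ / (3 * M + 3) * (3 * M + 3) :=
          mul_le_mul_of_nonneg_right (min_le_left _ _) h3.le
      _ = ρ := div_mul_cancel₀ ρ h3.ne'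
  by_cases hz : ‖z‖ ≤ 2 * M + 2
  · rcases le_or_gt 0 γ with hγ0 | hγ0
    · calc γ * (‖z‖ + M + 1) ≤ γ * (3 * M + 3) := mul_le_mul_of_nonneg_left (by linarith) hγ0
        _ ≤ ρ := hγρ
        _ ≤ ‖z - a‖ := hfar
    · have : γ * (‖z‖ + M + 1) ≤ 0 := mul_nonpos_of_nonpos_of_nonneg hγ0.le (by positivity)
      exact this.trans (norm_nonneg _)
  · have hz : 2 * M + 2 < ‖z‖ := lt_of_not_ge hz
    have h1 : ‖z‖ - ‖a‖ ≤ ‖z - a‖ := norm_sub_norm_le z a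
    have h2 : γ * (‖z‖ + M + 1) ≤ 1 / 3 * (‖z‖ + M + 1) :=
      mul_le_mul_of_nonneg_right hγ3 (by positivity)
    nlinarith

/-- The separation constant is positive. [folklore] -/
private theorem sepConst_pos {M ρ : ℝ} (hM : 0 ≤ M) (hρ : 0 < ρ) : 0 < min (ρ / (3 * M + 3)) (1 / 3) :=
  lt_min (div_pos hρ (by linarith)) (by norm_num)

/-- UPPER BOUND: if every root `a` of a split `f` has `‖a‖ ≤ M`, then
`‖f(z)‖ ≤ ‖lc f‖ · (‖z‖ + M + 1)^{#roots}`. [folklore] -/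
private theorem norm_eval_le_of_roots_le {f : K[X]} (hf : f.Splits) {M : ℝ}
    (hroots : ∀ a ∈ f.roots, ‖a‖ ≤ M) (z : K) :
    ‖f.eval z‖ ≤ ‖f.leadingCoeff‖ * (‖z‖ + M + 1) ^ Multiset.card f.roots := by
  rw [norm_eval_eq_prod_roots hf]
  refine mul_le_mul_of_nonneg_left ?_ (norm_nonneg _)
  refine prod_map_le_pow_card_of_le f.roots (fun a => ‖z - a‖) (fun a _ => norm_nonneg _) ?_
  intro a ha
  calc ‖z - a‖ ≤ ‖z‖ + ‖a‖ := norm_sub_le z a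
    _ ≤ ‖z‖ + M + 1 := by linarith [hroots a ha]

/-- LOWER BOUND: if every root `a` of a split `f` has `‖a‖ ≤ M` and `ρ ≤ ‖z − a‖`, then
`‖lc f‖ · (γ (‖z‖ + M + 1))^{#roots} ≤ ‖f(z)‖`. [folklore] -/
private theorem le_norm_eval_of_far {f : K[X]} (hf : f.Splits) {M ρ : ℝ} (hM : 0 ≤ M) (hρ : 0 < ρ)
    (hroots : ∀ a ∈ f.roots, ‖a‖ ≤ M) {z : K} (hfar : ∀ a ∈ f.roots, ρ ≤ ‖z - a‖) :
    ‖f.leadingCoeff‖ * (min (ρ / (3 * M + 3)) (1 / 3) * (‖z‖ + M + 1)) ^ Multiset.card f.roots ≤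
      ‖f.eval z‖ := by
  rw [norm_eval_eq_prod_roots hf]
  refine mul_le_mul_of_nonneg_left ?_ (norm_nonneg _)
  refine pow_card_le_prod_map_of_le f.roots (fun a => ‖z - a‖) ?_ ?_
  · exact mul_nonneg (sepConst_pos hM hρ).le (by positivity)
  · intro a ha
    exact sepConst_mul_le_norm_sub hM (hroots a ha) (hfar a ha)

/-! ### The annulus statement -/

/-- **W7-β, root form.** Let `p, q ∈ K[X]` split, with `p − q` split as well, all three of the
same degree `n` (i.e. `β := p/q` satisfies `β(∞) ∉ {0, 1, ∞}`), and let every root of `p`, `q`,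
`p − q` lie in the disc `‖a‖ ≤ M`. Then for every `ρ > 0` there is `ρ' > 0` such that for every
`z ∈ K` at distance `≥ ρ` from all these roots, `β(z) = p(z)/q(z)` lies in the annulus
`ρ' ≤ ‖β z‖ ≤ ρ'⁻¹`, `ρ' ≤ ‖β z − 1‖`. [cite: MochizukiGenEll2010, Thm 2.1 p.11] -/
theorem exists_annulus_of_far_roots {p q : K[X]} (hp : p.Splits) (hq : q.Splits)
    (hpq : (p - q).Splits) {n : ℕ} (hpn : p.natDegree = n) (hqn : q.natDegree = n)
    (hpqn : (p - q).natDegree = n) (hp0 : p ≠ 0) (hq0 : q ≠ 0) (hne : p ≠ q)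
    {M : ℝ} (hM : 0 ≤ M) (hMp : ∀ a ∈ p.roots, ‖a‖ ≤ M) (hMq : ∀ a ∈ q.roots, ‖a‖ ≤ M)
    (hMpq : ∀ a ∈ (p - q).roots, ‖a‖ ≤ M) {ρ : ℝ} (hρ : 0 < ρ) :
    ∃ ρ' : ℝ, 0 < ρ' ∧ ρ' ≤ 1 ∧ ∀ z : K,
      (∀ a ∈ p.roots, ρ ≤ ‖z - a‖) → (∀ a ∈ q.roots, ρ ≤ ‖z - a‖) →
      (∀ a ∈ (p - q).roots, ρ ≤ ‖z - a‖) →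
        ρ' ≤ ‖p.eval z / q.eval z‖ ∧ ‖p.eval z / q.eval z‖ ≤ ρ'⁻¹ ∧
          ρ' ≤ ‖p.eval z / q.eval z - 1‖ := by
  -- the constants
  set γ : ℝ := min (ρ / (3 * M + 3)) (1 / 3) with hγdef
  have hγ : 0 < γ := sepConst_pos hM hρ
  have hlp : 0 < ‖p.leadingCoeff‖ := norm_pos_iff.mpr (leadingCoeff_ne_zero.mpr hp0)
  have hlq : 0 < ‖q.leadingCoeff‖ := norm_pos_iff.mpr (leadingCoeff_ne_zero.mpr hq0)
  have hlpq : 0 < ‖(p - q).leadingCoeff‖ :=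
    norm_pos_iff.mpr (leadingCoeff_ne_zero.mpr (sub_ne_zero.mpr hne))
  set c₁ : ℝ := ‖p.leadingCoeff‖ / ‖q.leadingCoeff‖ * γ ^ n with hc₁
  set c₂ : ℝ := ‖q.leadingCoeff‖ / ‖p.leadingCoeff‖ * γ ^ n with hc₂
  set c₃ : ℝ := ‖(p - q).leadingCoeff‖ / ‖q.leadingCoeff‖ * γ ^ n with hc₃
  have hc₁0 : 0 < c₁ := by positivity
  have hc₂0 : 0 < c₂ := by positivity
  have hc₃0 : 0 < c₃ := by positivity
  refine ⟨min 1 (min c₁ (min c₂ c₃)), by positivity, min_le_left _ _, fun z hzp hzq hzpq => ?_⟩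
  -- card of roots
  have hcp : Multiset.card p.roots = n := by rw [← hp.natDegree_eq_card_roots, hpn]
  have hcq : Multiset.card q.roots = n := by rw [← hq.natDegree_eq_card_roots, hqn]
  have hcpq : Multiset.card (p - q).roots = n := by rw [← hpq.natDegree_eq_card_roots, hpqn]
  -- the two-sided bounds
  set U : ℝ := ‖z‖ + M + 1 with hU
  have hU0 : 0 < U := by positivity
  have hγU : 0 < γ * U := mul_pos hγ hU0
  have lp : ‖p.leadingCoeff‖ * (γ * U) ^ n ≤ ‖p.eval z‖ := by
    simpa only [hcp] using le_norm_eval_of_far hp hM hρ hMp hzp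
  have lq : ‖q.leadingCoeff‖ * (γ * U) ^ n ≤ ‖q.eval z‖ := by
    simpa only [hcq] using le_norm_eval_of_far hq hM hρ hMq hzq
  have lpq : ‖(p - q).leadingCoeff‖ * (γ * U) ^ n ≤ ‖(p - q).eval z‖ := by
    simpa only [hcpq] using le_norm_eval_of_far hpq hM hρ hMpq hzpq
  have up : ‖p.eval z‖ ≤ ‖p.leadingCoeff‖ * U ^ n := by
    simpa only [hcp] using norm_eval_le_of_roots_le hp hMp z
  have uq : ‖q.eval z‖ ≤ ‖q.leadingCoeff‖ * U ^ n := by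
    simpa only [hcq] using norm_eval_le_of_roots_le hq hMq z
  have hγUn : 0 < (γ * U) ^ n := pow_pos hγU n
  have hUn : 0 < U ^ n := pow_pos hU0 n
  have hqz : 0 < ‖q.eval z‖ := lt_of_lt_of_le (mul_pos hlq hγUn) lq
  have hpz : 0 < ‖p.eval z‖ := lt_of_lt_of_le (mul_pos hlp hγUn) lp
  have hqz' : q.eval z ≠ 0 := norm_pos_iff.mp hqz
  -- (γU)^n = γ^n U^n
  have hmulpow : (γ * U) ^ n = γ ^ n * U ^ n := mul_pow γ U n
  -- the three quotient bounds
  have b₁ : c₁ ≤ ‖p.eval z / q.eval z‖ := by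
    rw [norm_div, le_div_iff₀ hqz]
    calc c₁ * ‖q.eval z‖ ≤ c₁ * (‖q.leadingCoeff‖ * U ^ n) := mul_le_mul_of_nonneg_left uq hc₁0.le
      _ = ‖p.leadingCoeff‖ * (γ * U) ^ n := by
          rw [hc₁, hmulpow]; field_simp
      _ ≤ ‖p.eval z‖ := lp
  have b₂ : ‖p.eval z / q.eval z‖ ≤ c₂⁻¹ := by
    rw [norm_div, div_le_iff₀ hqz]
    have : ‖p.eval z‖ * c₂ ≤ ‖q.eval z‖ := by
      calc ‖p.eval z‖ * c₂ ≤ ‖p.leadingCoeff‖ * U ^ n * c₂ := mul_le_mul_of_nonneg_right up hc₂0.le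
        _ = ‖q.leadingCoeff‖ * (γ * U) ^ n := by
            rw [hc₂, hmulpow]; field_simp
        _ ≤ ‖q.eval z‖ := lq
    calc ‖p.eval z‖ = ‖p.eval z‖ * c₂ * c₂⁻¹ := by field_simp
      _ ≤ ‖q.eval z‖ * c₂⁻¹ := mul_le_mul_of_nonneg_right this (inv_pos.mpr hc₂0).le
      _ = c₂⁻¹ * ‖q.eval z‖ := mul_comm _ _
  have b₃ : c₃ ≤ ‖p.eval z / q.eval z - 1‖ := by
    have hsub : p.eval z / q.eval z - 1 = (p - q).eval z / q.eval z := by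
      rw [eval_sub]; field_simp
    rw [hsub, norm_div, le_div_iff₀ hqz]
    calc c₃ * ‖q.eval z‖ ≤ c₃ * (‖q.leadingCoeff‖ * U ^ n) := mul_le_mul_of_nonneg_left uq hc₃0.le
      _ = ‖(p - q).leadingCoeff‖ * (γ * U) ^ n := by
          rw [hc₃, hmulpow]; field_simp
      _ ≤ ‖(p - q).eval z‖ := lpq
  refine ⟨?_, ?_, ?_⟩
  · exact (min_le_right _ _).trans ((min_le_left _ _).trans b₁)
  · refine b₂.trans ?_
    exact inv_anti₀ (by positivity)
      ((min_le_right _ _).trans ((min_le_right _ _).trans (min_le_left _ _)))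
  · exact (min_le_right _ _).trans ((min_le_right _ _).trans ((min_le_right _ _).trans b₃))

/-- **W7-β, finite-set form.** As `exists_annulus_of_far_roots`, with one set `B ⊆ K` containing all
roots of `p`, `q`, `p − q` (= the affine fibre `β⁻¹{0, ∞, 1}` of `β = p/q`) and contained in the disc
`‖b‖ ≤ M`: points `ρ`-far from `B` are mapped by `β` into the annulus of parameter `ρ'`.
[cite: MochizukiGenEll2010, Thm 2.1 p.11] -/
theorem exists_annulus_of_far {p q : K[X]} (hp : p.Splits) (hq : q.Splits)
    (hpq : (p - q).Splits) {n : ℕ} (hpn : p.natDegree = n) (hqn : q.natDegree = n)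
    (hpqn : (p - q).natDegree = n) (hp0 : p ≠ 0) (hq0 : q ≠ 0) (hne : p ≠ q)
    {B : Set K} (hBp : ∀ a ∈ p.roots, a ∈ B) (hBq : ∀ a ∈ q.roots, a ∈ B)
    (hBpq : ∀ a ∈ (p - q).roots, a ∈ B) {M : ℝ} (hM : 0 ≤ M) (hBM : ∀ b ∈ B, ‖b‖ ≤ M)
    {ρ : ℝ} (hρ : 0 < ρ) :
    ∃ ρ' : ℝ, 0 < ρ' ∧ ρ' ≤ 1 ∧ ∀ z : K, (∀ b ∈ B, ρ ≤ ‖z - b‖) →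
      ρ' ≤ ‖p.eval z / q.eval z‖ ∧ ‖p.eval z / q.eval z‖ ≤ ρ'⁻¹ ∧
        ρ' ≤ ‖p.eval z / q.eval z - 1‖ := by
  obtain ⟨ρ', hρ', hρ'1, h⟩ := exists_annulus_of_far_roots hp hq hpq hpn hqn hpqn hp0 hq0 hne hM
    (fun a ha => hBM a (hBp a ha)) (fun a ha => hBM a (hBq a ha)) (fun a ha => hBM a (hBpq a ha)) hρ
  exact ⟨ρ', hρ', hρ'1, fun z hz => h z (fun a ha => hz a (hBp a ha)) (fun a ha => hz a (hBq a ha))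
    fun a ha => hz a (hBpq a ha)⟩

end NormedField

/-! ### Over an algebraically closed normed field (`ℂ`, `Q̄_p`): splitting is automatic -/

section IsAlgClosed

variable {K : Type*} [NormedField K] [IsAlgClosed K]

/-- **W7-β over an algebraically closed normed field** (`K = ℂ` at the archimedean place, `K = Q̄_2`
at the `2`-adic one): for `β = p/q` with `deg p = deg q = deg (p − q) = n` (`β(∞) ∉ {0,1,∞}`) and a
set `B` containing the roots of `p`, `q`, `p − q` inside a disc `‖b‖ ≤ M`, points `ρ`-far from `B`
land in the annulus `ρ' ≤ |β| ≤ 1/ρ'`, `|β − 1| ≥ ρ'`. [cite: MochizukiGenEll2010, Thm 2.1 p.11] -/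
theorem exists_annulus_of_far_of_isAlgClosed {p q : K[X]} {n : ℕ} (hpn : p.natDegree = n)
    (hqn : q.natDegree = n) (hpqn : (p - q).natDegree = n) (hp0 : p ≠ 0) (hq0 : q ≠ 0)
    (hne : p ≠ q) {B : Set K} (hBp : ∀ a ∈ p.roots, a ∈ B) (hBq : ∀ a ∈ q.roots, a ∈ B)
    (hBpq : ∀ a ∈ (p - q).roots, a ∈ B) {M : ℝ} (hM : 0 ≤ M) (hBM : ∀ b ∈ B, ‖b‖ ≤ M)
    {ρ : ℝ} (hρ : 0 < ρ) :
    ∃ ρ' : ℝ, 0 < ρ' ∧ ρ' ≤ 1 ∧ ∀ z : K, (∀ b ∈ B, ρ ≤ ‖z - b‖) →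
      ρ' ≤ ‖p.eval z / q.eval z‖ ∧ ‖p.eval z / q.eval z‖ ≤ ρ'⁻¹ ∧
        ρ' ≤ ‖p.eval z / q.eval z - 1‖ :=
  exists_annulus_of_far (IsAlgClosed.splits p) (IsAlgClosed.splits q) (IsAlgClosed.splits _)
    hpn hqn hpqn hp0 hq0 hne hBp hBq hBpq hM hBM hρ

end IsAlgClosed

end Literature.NumberTheory.DiophantineGeometry.GenEll
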